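import Summits.HubbardSuperconductivity.HubbardSuperconductivity.Theorems.AnisotropyChordTransferFibre3RowDLoopWSNorms
import Summits.HubbardSuperconductivity.HubbardSuperconductivity.Theorems.AnisotropyChordTransferFibre3RowDTLoopNorms
import Summits.HubbardSuperconductivity.HubbardSuperconductivity.Theorems.AnisotropyChordTransferFibre3ManifoldA64

/-!
# Route `AnisotropyChord` / H0 rotor rung, row D (KT-2a) on the t-BLOCKS: block twin of `…AnisotropyChordTransferFibre3RowDLoopWSNorms`

T-FORK (p2 g8; inventory memo HOME/hubbard-h0-rotor-p2/TBLOCK-INVENTORY-g8.md §3): the theorems of `…RowDLoopWSNorms` that carry the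
hypothesis `128 ≤ L` (or the `L2.NamedCell` cell box) restated in the namespace `RowD.T` with the SAME names for the t-blocks of
the range `48 ≤ L < 128` (route-lead ruling R1): analytic layer with `64 ≤ L` (family A at `L ≥ 64`: `ManifoldA.nu_ceiling64`,
`manifold_band64`), cell layer on block cells `c : L2.TCell` (`cellBoxB (c.box a₁ a₂)`, `pmem_xTrueT`,
`RowC.finalVec_mem_of_cellFinalBoxT`).  Definitions that do not depend on the cell are NOT duplicated (they resolve to `RowD`);
proofs are verbatim.  Kept: norm_loop3S_le_WS, norm_loop3S_le_direct, norm_loopPartU_S12_le_WS, norm_loopPartU_S31_le_WS, norm_loopPartU_S32_le_WS, norm_nLoopU_SSS_le_WS, norm_nvLoopU_SSS_le_WS.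
Prover seat `hubbard-h0-rotor-p2` g8; helper for piece A = stmt-HubbardSuperconductivity-23918 of rung 19089 (`--supports`, helper
class).  Nothing here proves superconductivity in the Hubbard model; lemmas for ONE row of ONE conditional reduction on the t-blocks;
the rotor TARGET as originally worded stays FALSE (g15 verdict).  Tree imports only; no sorry.
-/

set_option linter.dupNamespace false
set_option autoImplicit false

open scoped BigOperators

namespace Summit.HubbardSuperconductivity.HubbardSuperconductivity.Theorems.AnisotropyChord.Transfer.Fibre3

namespace RowD

namespace T

open RowC L2.N1

variable (L : ℕ) [NeZero L]

section sss
variable (Δ lam2 : ℝ) (f : Tor L → ℝ)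

/-- ★ `SSS` three-leg product, Cauchy–Schwarz/`WS` form: with `d₁ = mixShift σw σu cw cu = toTor d̄₁`, `d₂ = … = toTor d̄₂` and certified
`θ⁴·B1.wloopSum L λ₂ 0 d̄ᵢ d̄ᵢ eᵢ eᵢ ≤ χᵢ`:  `‖Σ_p R_S⁰(ℓu p) R_Sʷ(ℓw p) R_Sʷ′(ℓw′ p)‖ ≤ c_s³·√(χ₁χ₂)/θ⁴`. [folklore] -/
theorem norm_loop3S_le_WS (hL : 64 ≤ L) (hΔ0 : 0 ≤ Δ) (hΔ1 : Δ < 1) (hf : IsGroundTwoMagnon L Δ lam2 f) (eu : Tor L) (ew ew' : ℤ × ℤ)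
    (σu : Bool) (cu : Tor L) (σw : Bool) (cw : Tor L) (σw' : Bool) (cw' : Tor L) (d₁ d₂ : ℤ × ℤ)
    (hd₁ : mixShift L σw σu cw cu = B1.toTor L d₁) (hd₂ : mixShift L σw' σu cw' cu = B1.toTor L d₂)
    {χ₁ χ₂ : ℝ} (hχ₁ : ((2 * Real.pi / L) ^ 2) ^ 2 * B1.wloopSum L lam2 0 d₁ d₁ ew ew ≤ χ₁)
    (hχ₂ : ((2 * Real.pi / L) ^ 2) ^ 2 * B1.wloopSum L lam2 0 d₂ d₂ ew' ew' ≤ χ₂) :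
    ‖∑ p : Tor L, RfacU L lam2 (psiU L Δ lam2 f true 1 0 eu) (affine L σu cu p)
        * RfacU L lam2 (psiU L Δ lam2 f true 1 (-1) (B1.toTor L ew)) (affine L σw cw p)
        * RfacU L lam2 (psiU L Δ lam2 f true 1 (-1) (B1.toTor L ew')) (affine L σw' cw' p)‖
      ≤ cS L Δ lam2 f ^ 3 * (Real.sqrt (χ₁ * χ₂) / ((2 * Real.pi / L) ^ 2) ^ 2) := by
  obtain ⟨_, hcs0, _, hν, _⟩ := slot_regime L Δ lam2 f hL hΔ0 hΔ1 hf
  refine (norm_sum_le _ _).trans ?_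
  simp only [norm_mul, norm_plain L Δ lam2 f hL hΔ0 hΔ1 hf, norm_grad L Δ lam2 f hL hΔ0 hΔ1 hf, if_true]
  have hfam := fam_gww_WS_cert L lam2 hν σu cu σw cw σw' cw' d₁ d₂ ew ew' hd₁ hd₂ hχ₁ hχ₂
  calc ∑ p, cS L Δ lam2 f * gres L lam2 (affine L σu cu p)
        * (wnorm L (affine L σw cw p) (B1.toTor L ew) * (cS L Δ lam2 f * gres L lam2 (affine L σw cw p)))
        * (wnorm L (affine L σw' cw' p) (B1.toTor L ew') * (cS L Δ lam2 f * gres L lam2 (affine L σw' cw' p)))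
      = cS L Δ lam2 f ^ 3 * ∑ p, gres L lam2 (affine L σu cu p)
          * (wnorm L (affine L σw cw p) (B1.toTor L ew) * gres L lam2 (affine L σw cw p))
          * (wnorm L (affine L σw' cw' p) (B1.toTor L ew') * gres L lam2 (affine L σw' cw' p)) := by
        rw [Finset.mul_sum]; exact Finset.sum_congr rfl fun p _ => by ring
    _ ≤ cS L Δ lam2 f ^ 3 * (Real.sqrt (χ₁ * χ₂) / ((2 * Real.pi / L) ^ 2) ^ 2) :=
        mul_le_mul_of_nonneg_left hfam (pow_nonneg hcs0 3)

/-- ★ `SSS` three-leg product, DIRECT form: with `dᵢ = toTor d̄ᵢ` as above and ONE certified constant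
`θ⁴·B1.wloopSum L λ₂ 0 d̄₁ d̄₂ e e′ ≤ χ`:  `‖Σ_p R_S⁰(ℓu p) R_Sʷ(ℓw p) R_Sʷ′(ℓw′ p)‖ ≤ c_s³·χ/θ⁴`. [folklore] -/
theorem norm_loop3S_le_direct (hL : 64 ≤ L) (hΔ0 : 0 ≤ Δ) (hΔ1 : Δ < 1) (hf : IsGroundTwoMagnon L Δ lam2 f) (eu : Tor L) (ew ew' : ℤ × ℤ)
    (σu : Bool) (cu : Tor L) (σw : Bool) (cw : Tor L) (σw' : Bool) (cw' : Tor L) (d₁ d₂ : ℤ × ℤ)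
    (hd₁ : mixShift L σw σu cw cu = B1.toTor L d₁) (hd₂ : mixShift L σw' σu cw' cu = B1.toTor L d₂)
    {χ : ℝ} (hχ : ((2 * Real.pi / L) ^ 2) ^ 2 * B1.wloopSum L lam2 0 d₁ d₂ ew ew' ≤ χ) :
    ‖∑ p : Tor L, RfacU L lam2 (psiU L Δ lam2 f true 1 0 eu) (affine L σu cu p)
        * RfacU L lam2 (psiU L Δ lam2 f true 1 (-1) (B1.toTor L ew)) (affine L σw cw p)
        * RfacU L lam2 (psiU L Δ lam2 f true 1 (-1) (B1.toTor L ew')) (affine L σw' cw' p)‖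
      ≤ cS L Δ lam2 f ^ 3 * (χ / ((2 * Real.pi / L) ^ 2) ^ 2) := by
  obtain ⟨_, hcs0, _, hν, _⟩ := slot_regime L Δ lam2 f hL hΔ0 hΔ1 hf
  refine (norm_sum_le _ _).trans ?_
  simp only [norm_mul, norm_plain L Δ lam2 f hL hΔ0 hΔ1 hf, norm_grad L Δ lam2 f hL hΔ0 hΔ1 hf, if_true]
  have hfam := fam_gww_direct_cert L lam2 σu cu σw cw σw' cw' d₁ d₂ ew ew' hd₁ hd₂ hχ
  calc ∑ p, cS L Δ lam2 f * gres L lam2 (affine L σu cu p)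
        * (wnorm L (affine L σw cw p) (B1.toTor L ew) * (cS L Δ lam2 f * gres L lam2 (affine L σw cw p)))
        * (wnorm L (affine L σw' cw' p) (B1.toTor L ew') * (cS L Δ lam2 f * gres L lam2 (affine L σw' cw' p)))
      = cS L Δ lam2 f ^ 3 * ∑ p, gres L lam2 (affine L σu cu p)
          * (wnorm L (affine L σw cw p) (B1.toTor L ew) * gres L lam2 (affine L σw cw p))
          * (wnorm L (affine L σw' cw' p) (B1.toTor L ew') * gres L lam2 (affine L σw' cw' p)) := by
        rw [Finset.mul_sum]; exact Finset.sum_congr rfl fun p _ => by ring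
    _ ≤ cS L Δ lam2 f ^ 3 * (χ / ((2 * Real.pi / L) ^ 2) ^ 2) :=
        mul_le_mul_of_nonneg_left hfam (pow_nonneg hcs0 3)

/-! ## The three `SSS` patterns at integer momenta -/

/-- ★ pattern `12` (slot 3 plain; legs `p, k₂+p, k₃−p`): `‖loopPartU(ψ₃⁰, ψ₁ʷᵉ, ψ₂ʷᵉ′)(k̄₂,k̄₃)‖ ≤ c_s³·√(χχ′)/(θ⁴V)` with
`χ ≥ θ⁴·WS_e(k̄₂)`, `χ′ ≥ θ⁴·WS_{e′}(−k̄₃)`. [folklore] -/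
theorem norm_loopPartU_S12_le_WS (hL : 64 ≤ L) (hΔ0 : 0 ≤ Δ) (hΔ1 : Δ < 1) (hf : IsGroundTwoMagnon L Δ lam2 f)
    (e0 : Tor L) (e e' k₂ k₃ : ℤ × ℤ) {χ χ' : ℝ}
    (hχ : ((2 * Real.pi / L) ^ 2) ^ 2 * B1.wloopSum L lam2 0 k₂ k₂ e e ≤ χ)
    (hχ' : ((2 * Real.pi / L) ^ 2) ^ 2 * B1.wloopSum L lam2 0 (-k₃) (-k₃) e' e' ≤ χ') :
    ‖loopPartU L lam2 (psiU L Δ lam2 f true 1 0 e0) (psiU L Δ lam2 f true 1 (-1) (B1.toTor L e))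
        (psiU L Δ lam2 f true 1 (-1) (B1.toTor L e')) (B1.toTor L k₂) (B1.toTor L k₃)‖
      ≤ cS L Δ lam2 f ^ 3 * (Real.sqrt (χ * χ') / ((2 * Real.pi / L) ^ 2) ^ 2) / (L : ℝ) ^ 2 := by
  rw [norm_loopPartU_eq]
  have hd₁ : mixShift L false false (B1.toTor L k₂) 0 = B1.toTor L k₂ := by unfold mixShift; simp
  have hd₂ : mixShift L true false (B1.toTor L k₃) 0 = B1.toTor L (-k₃) := by
    unfold mixShift; simp [B1.toTor_neg]
  have h := norm_loop3S_le_WS L Δ lam2 f hL hΔ0 hΔ1 hf e0 e e' false 0 false (B1.toTor L k₂) true (B1.toTor L k₃)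
    k₂ (-k₃) hd₁ hd₂ hχ hχ'
  simp only [affine_false, affine_true, zero_add] at h
  exact div_le_div_of_nonneg_right h (by positivity)

/-- ★ pattern `31` (slot 2 plain; weighted legs `p, k₂+p`, plain `k₃−p`): `‖loopPartU(ψ₃ʷᵉ, ψ₁ʷᵉ′, ψ₂⁰)(k̄₂,k̄₃)‖ ≤ c_s³·√(χχ′)/(θ⁴V)` with
`χ ≥ θ⁴·WS_e(−k̄₃)`, `χ′ ≥ θ⁴·WS_{e′}(−(k̄₂+k̄₃))`. [folklore] -/
theorem norm_loopPartU_S31_le_WS (hL : 64 ≤ L) (hΔ0 : 0 ≤ Δ) (hΔ1 : Δ < 1) (hf : IsGroundTwoMagnon L Δ lam2 f)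
    (e0 : Tor L) (e e' k₂ k₃ : ℤ × ℤ) {χ χ' : ℝ}
    (hχ : ((2 * Real.pi / L) ^ 2) ^ 2 * B1.wloopSum L lam2 0 (-k₃) (-k₃) e e ≤ χ)
    (hχ' : ((2 * Real.pi / L) ^ 2) ^ 2 * B1.wloopSum L lam2 0 (-(k₂ + k₃)) (-(k₂ + k₃)) e' e' ≤ χ') :
    ‖loopPartU L lam2 (psiU L Δ lam2 f true 1 (-1) (B1.toTor L e)) (psiU L Δ lam2 f true 1 (-1) (B1.toTor L e'))
        (psiU L Δ lam2 f true 1 0 e0) (B1.toTor L k₂) (B1.toTor L k₃)‖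
      ≤ cS L Δ lam2 f ^ 3 * (Real.sqrt (χ * χ') / ((2 * Real.pi / L) ^ 2) ^ 2) / (L : ℝ) ^ 2 := by
  rw [norm_loopPartU_eq]
  have hd₁ : mixShift L false true 0 (B1.toTor L k₃) = B1.toTor L (-k₃) := by
    unfold mixShift; simp [B1.toTor_neg]
  have hd₂ : mixShift L false true (B1.toTor L k₂) (B1.toTor L k₃) = B1.toTor L (-(k₂ + k₃)) := by
    unfold mixShift; simp [B1.toTor_neg, B1.toTor_add]
  have h := norm_loop3S_le_WS L Δ lam2 f hL hΔ0 hΔ1 hf e0 e e' true (B1.toTor L k₃) false 0 false (B1.toTor L k₂)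
    (-k₃) (-(k₂ + k₃)) hd₁ hd₂ hχ hχ'
  simp only [affine_false, affine_true, zero_add] at h
  refine div_le_div_of_nonneg_right (le_of_eq_of_le ?_ h) (by positivity)
  congr 1; exact Finset.sum_congr rfl fun p _ => by ring

/-- ★ pattern `32` (slot 1 plain; weighted legs `p, k₃−p`, plain `k₂+p`): `‖loopPartU(ψ₃ʷᵉ, ψ₁⁰, ψ₂ʷᵉ′)(k̄₂,k̄₃)‖ ≤ c_s³·√(χχ′)/(θ⁴V)` with
`χ ≥ θ⁴·WS_e(−k̄₂)`, `χ′ ≥ θ⁴·WS_{e′}(−(k̄₂+k̄₃))`. [folklore] -/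
theorem norm_loopPartU_S32_le_WS (hL : 64 ≤ L) (hΔ0 : 0 ≤ Δ) (hΔ1 : Δ < 1) (hf : IsGroundTwoMagnon L Δ lam2 f)
    (e0 : Tor L) (e e' k₂ k₃ : ℤ × ℤ) {χ χ' : ℝ}
    (hχ : ((2 * Real.pi / L) ^ 2) ^ 2 * B1.wloopSum L lam2 0 (-k₂) (-k₂) e e ≤ χ)
    (hχ' : ((2 * Real.pi / L) ^ 2) ^ 2 * B1.wloopSum L lam2 0 (-(k₂ + k₃)) (-(k₂ + k₃)) e' e' ≤ χ') :
    ‖loopPartU L lam2 (psiU L Δ lam2 f true 1 (-1) (B1.toTor L e)) (psiU L Δ lam2 f true 1 0 e0)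
        (psiU L Δ lam2 f true 1 (-1) (B1.toTor L e')) (B1.toTor L k₂) (B1.toTor L k₃)‖
      ≤ cS L Δ lam2 f ^ 3 * (Real.sqrt (χ * χ') / ((2 * Real.pi / L) ^ 2) ^ 2) / (L : ℝ) ^ 2 := by
  rw [norm_loopPartU_eq]
  have hd₁ : mixShift L false false 0 (B1.toTor L k₂) = B1.toTor L (-k₂) := by
    unfold mixShift; simp [B1.toTor_neg]
  have hd₂ : mixShift L true false (B1.toTor L k₃) (B1.toTor L k₂) = B1.toTor L (-(k₂ + k₃)) := by
    unfold mixShift; simp [B1.toTor_neg, B1.toTor_add]; abel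
  have h := norm_loop3S_le_WS L Δ lam2 f hL hΔ0 hΔ1 hf e0 e e' false (B1.toTor L k₂) false 0 true (B1.toTor L k₃)
    (-k₂) (-(k₂ + k₃)) hd₁ hd₂ hχ hχ'
  simp only [affine_false, affine_true, zero_add] at h
  refine div_le_div_of_nonneg_right (le_of_eq_of_le ?_ h) (by positivity)
  congr 1; exact Finset.sum_congr rfl fun p _ => by ring

/-! ## The `SSS` N-loops with a certified table -/

/-- ★★ `‖nLoopU S S S e0 k̄₂ k̄₃‖ ≤ ½·(Σ_{e ∈ E4} sssConst c_s ws k̄₂ k̄₃ e)/(θ⁴V)` for a table `ws` with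
`θ⁴·B1.wloopSum L λ₂ 0 d d e e ≤ ws e d` for all `e ∈ E4`, `d ∈ {k̄₂, −k̄₃, −k̄₂, −(k̄₂+k̄₃)}`. [folklore] -/
theorem norm_nLoopU_SSS_le_WS (hL : 64 ≤ L) (hΔ0 : 0 ≤ Δ) (hΔ1 : Δ < 1) (hf : IsGroundTwoMagnon L Δ lam2 f)
    (e0 : Tor L) (k₂ k₃ : ℤ × ℤ) (ws : ℤ × ℤ → ℤ × ℤ → ℝ)
    (hws : ∀ e ∈ E4, ∀ d ∈ [k₂, -k₃, -k₂, -(k₂ + k₃)],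
      ((2 * Real.pi / L) ^ 2) ^ 2 * B1.wloopSum L lam2 0 d d e e ≤ ws e d) :
    ‖nLoopU L Δ lam2 f true true true e0 (B1.toTor L k₂) (B1.toTor L k₃)‖
      ≤ (1 / 2) * (((E4.map fun e => sssConst (cS L Δ lam2 f) ws k₂ k₃ e).sum)
          / ((2 * Real.pi / L) ^ 2) ^ 2 / (L : ℝ) ^ 2) := by
  have T : ∀ e ∈ E4,
      ‖loopPartU L lam2 (psiU L Δ lam2 f true 1 0 e0) (psiU L Δ lam2 f true 1 (-1) (B1.toTor L e))
          (psiU L Δ lam2 f true 1 (-1) (B1.toTor L e)) (B1.toTor L k₂) (B1.toTor L k₃)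
        + loopPartU L lam2 (psiU L Δ lam2 f true 1 (-1) (B1.toTor L e)) (psiU L Δ lam2 f true 1 (-1) (-(B1.toTor L e)))
          (psiU L Δ lam2 f true 1 0 e0) (B1.toTor L k₂) (B1.toTor L k₃)
        + loopPartU L lam2 (psiU L Δ lam2 f true 1 (-1) (B1.toTor L e)) (psiU L Δ lam2 f true 1 0 e0)
          (psiU L Δ lam2 f true 1 (-1) (B1.toTor L e)) (B1.toTor L k₂) (B1.toTor L k₃)‖
      ≤ sssConst (cS L Δ lam2 f) ws k₂ k₃ e / ((2 * Real.pi / L) ^ 2) ^ 2 / (L : ℝ) ^ 2 := by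
    intro e he
    have h1 := hws e he k₂ (by simp)
    have h2 := hws e he (-k₃) (by simp)
    have h3 := hws e he (-k₂) (by simp)
    have h4 := hws e he (-(k₂ + k₃)) (by simp)
    have h2' : ((2 * Real.pi / L) ^ 2) ^ 2 * B1.wloopSum L lam2 0 (-k₃) (-k₃) (-e) (-e) ≤ ws e (-k₃) := by
      rw [wloopSum_neg_e₁, wloopSum_neg_e₂]; exact h2
    have h4' : ((2 * Real.pi / L) ^ 2) ^ 2 * B1.wloopSum L lam2 0 (-(k₂ + k₃)) (-(k₂ + k₃)) (-e) (-e) ≤ ws e (-(k₂ + k₃)) := by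
      rw [wloopSum_neg_e₁, wloopSum_neg_e₂]; exact h4
    have A := norm_loopPartU_S12_le_WS L Δ lam2 f hL hΔ0 hΔ1 hf e0 e e k₂ k₃ h1 h2
    have B := norm_loopPartU_S31_le_WS L Δ lam2 f hL hΔ0 hΔ1 hf e0 e (-e) k₂ k₃ h2 h4'
    have C := norm_loopPartU_S32_le_WS L Δ lam2 f hL hΔ0 hΔ1 hf e0 e e k₂ k₃ h3 h4
    rw [B1.toTor_neg] at B
    have hs := norm_add_le_of_le (norm_add_le_of_le A B) C
    refine hs.trans (le_of_eq ?_)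
    unfold sssConst
    ring
  have e1 := T (1, 0) (by decide)
  have e2 := T (-1, 0) (by decide)
  have e3 := T (0, 1) (by decide)
  have e4 := T (0, -1) (by decide)
  unfold nLoopU
  rw [nnList_eq_map]
  simp only [E4, List.map, List.sum_cons, List.sum_nil, add_zero, norm_mul, norm_neg, norm_div, norm_one,
    Complex.norm_ofNat]
  have hs := norm_add_le_of_le e1 (norm_add_le_of_le e2 (norm_add_le_of_le e3 e4))
  refine (mul_le_mul_of_nonneg_left hs (by norm_num)).trans (le_of_eq ?_)
  ring

/-- ★★ `‖nvLoopU S S S e0 k̄₂ k̄₃‖` ≤ the sum of the three translate bounds (`(k̄₂,k̄₃)`, `(k̄₂−x̂,k̄₃)`, `(k̄₂,k̄₃−x̂)`), each with its own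
table hypothesis. [folklore] -/
theorem norm_nvLoopU_SSS_le_WS (hL : 64 ≤ L) (hΔ0 : 0 ≤ Δ) (hΔ1 : Δ < 1) (hf : IsGroundTwoMagnon L Δ lam2 f)
    (e0 : Tor L) (k₂ k₃ : ℤ × ℤ) (ws : ℤ × ℤ → ℤ × ℤ → ℝ)
    (hws₀ : ∀ e ∈ E4, ∀ d ∈ [k₂, -k₃, -k₂, -(k₂ + k₃)],
      ((2 * Real.pi / L) ^ 2) ^ 2 * B1.wloopSum L lam2 0 d d e e ≤ ws e d)
    (hws₁ : ∀ e ∈ E4, ∀ d ∈ [k₂ - (1, 0), -k₃, -(k₂ - (1, 0)), -(k₂ - (1, 0) + k₃)],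
      ((2 * Real.pi / L) ^ 2) ^ 2 * B1.wloopSum L lam2 0 d d e e ≤ ws e d)
    (hws₂ : ∀ e ∈ E4, ∀ d ∈ [k₂, -(k₃ - (1, 0)), -k₂, -(k₂ + (k₃ - (1, 0)))],
      ((2 * Real.pi / L) ^ 2) ^ 2 * B1.wloopSum L lam2 0 d d e e ≤ ws e d) :
    ‖nvLoopU L Δ lam2 f true true true e0 (B1.toTor L k₂) (B1.toTor L k₃)‖
      ≤ (1 / 2) * (((E4.map fun e => sssConst (cS L Δ lam2 f) ws k₂ k₃ e).sum)
          / ((2 * Real.pi / L) ^ 2) ^ 2 / (L : ℝ) ^ 2)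
        + (1 / 2) * (((E4.map fun e => sssConst (cS L Δ lam2 f) ws (k₂ - (1, 0)) k₃ e).sum)
          / ((2 * Real.pi / L) ^ 2) ^ 2 / (L : ℝ) ^ 2)
        + (1 / 2) * (((E4.map fun e => sssConst (cS L Δ lam2 f) ws k₂ (k₃ - (1, 0)) e).sum)
          / ((2 * Real.pi / L) ^ 2) ^ 2 / (L : ℝ) ^ 2) := by
  unfold nvLoopU
  have h1 := norm_nLoopU_SSS_le_WS L Δ lam2 f hL hΔ0 hΔ1 hf e0 k₂ k₃ ws hws₀
  have h2 := norm_nLoopU_SSS_le_WS L Δ lam2 f hL hΔ0 hΔ1 hf e0 (k₂ - (1, 0)) k₃ ws hws₁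
  have h3 := norm_nLoopU_SSS_le_WS L Δ lam2 f hL hΔ0 hΔ1 hf e0 k₂ (k₃ - (1, 0)) ws hws₂
  rw [toTor_sub_K1, toTor_sub_K1]
  exact norm_add_le_of_le (norm_add_le_of_le h1 h2) h3

end sss

end T

end RowD

end Summit.HubbardSuperconductivity.HubbardSuperconductivity.Theorems.AnisotropyChord.Transfer.Fibre3
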